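import Mathlib
import Literature.MathematicalPhysics.StatisticalMechanics.BarlowStacking

/-!
# Route `NashClassCertificates`, crux `NashNearField` (stmt-AtomisticToContinuum-16827), line `birth`:
# pieces for the stub `stub_smoothRegimeCoercivity` (B″), II — locality and periodisation of Hägg words

The flatness witnesses of B″ carry ARBITRARY Hägg words `s_i : ℤ → {±1}`, while the Cauchy–Born floor
(`e* ≤ e(Q)` for the affine image `Q` of a Barlow PERIODIC configuration, `PeriodicConfiguration.linearImage` +
`barlowPeriodicConfiguration`) needs a periodic word.  The two facts that bridge this:

* `haggLabel_eq_of_agree`, `stub_barlowPos_eq_of_agree` — **locality of the template**: the layer labels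
  `haggLabel s k`, hence the template sites `barlowPos a h s k i j`, for `−K ≤ k ≤ K` depend only on the letters
  `s i`, `−K ≤ i < K`;
* `stub_existsPeriodicHaggAgree` — **periodisation**: every Hägg word agrees on the window `[−K, K]` with a
  `(2K+1)`-periodic Hägg word (the periodic extension of its restriction to `[−K, K]`).

Hence the radius-`R` unit template of any word is the radius-`R` unit template of a periodic word (take
`K ≥ R/(√6/3)`), to which the periodic Cauchy–Born floor applies.  All `[folklore]`.
-/

noncomputable section

open Literature.MathematicalPhysics.StatisticalMechanics

namespace Summit.AtomisticToContinuum.Crystallization.Theorems.NashClassCertificatesNashNearField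

/-- Window sums only read the letters inside the window. [folklore] -/
theorem haggWindow_eq_of_agree {s s' : ℤ → ℤ} {m : ℤ} {n : ℕ}
    (h : ∀ i : ℤ, m ≤ i → i < m + n → s' i = s i) :
    haggWindow s' m n = haggWindow s m n := by
  rw [haggWindow_eq, haggWindow_eq]
  refine Finset.sum_congr rfl fun i hi => ?_
  rw [Finset.mem_range] at hi
  exact h (m + i) (by omega) (by omega)

/-- **Locality of the layer labels.**  If two words agree on the letters `−K ≤ i < K`, their layer labels
agree on the layers `−K ≤ k ≤ K` (`L 0 = 0`, `L (k+1) = L k + s k`). [folklore] -/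
theorem haggLabel_eq_of_agree {s s' : ℤ → ℤ} {K : ℕ}
    (h : ∀ i : ℤ, -(K : ℤ) ≤ i → i < K → s' i = s i) {k : ℤ} (hk₁ : -(K : ℤ) ≤ k) (hk₂ : k ≤ K) :
    haggLabel s' k = haggLabel s k := by
  rcases le_or_gt 0 k with hk | hk
  · -- `k = n ≥ 0`: `L n = haggWindow s 0 n`
    obtain ⟨n, rfl⟩ : ∃ n : ℕ, k = n := ⟨k.toNat, by omega⟩
    rw [haggLabel_natCast, haggLabel_natCast]
    exact haggWindow_eq_of_agree fun i hi1 hi2 => h i (by omega) (by omega)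
  · -- `k = -n < 0`: `L (-n) = -haggWindow s (-n) n`
    obtain ⟨n, rfl⟩ : ∃ n : ℕ, k = -(n : ℤ) := ⟨(-k).toNat, by omega⟩
    rw [haggLabel_neg_natCast, haggLabel_neg_natCast]
    congr 1
    exact haggWindow_eq_of_agree fun i hi1 hi2 => h i (by omega) (by omega)

/-- **Stub piece `stub_barlowPos_eq_of_agree`: locality of the Barlow template (proved).**  If two words agree on
the letters `−K ≤ i < K`, then their Barlow templates (any spacings `a`, `h`) have the same sites on the layers
`−K ≤ k ≤ K`: `barlowPos a h s' k i j = barlowPos a h s k i j`.  In particular the radius-`R` unit template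
(`h = √6/3`, layers `|k| ≤ R/(√6/3)`) of a word is determined by finitely many of its letters. [folklore] -/
theorem stub_barlowPos_eq_of_agree :
    ∀ (a h : ℝ) (s s' : ℤ → ℤ) (K : ℕ), (∀ i : ℤ, -(K : ℤ) ≤ i → i < K → s' i = s i) →
      ∀ k i j : ℤ, -(K : ℤ) ≤ k → k ≤ K → barlowPos a h s' k i j = barlowPos a h s k i j := by
  intro a h s s' K hagree k i j hk₁ hk₂
  unfold barlowPos
  rw [haggLabel_eq_of_agree hagree hk₁ hk₂]

/-- **Stub piece `stub_existsPeriodicHaggAgree`: periodisation of a Hägg word (proved).**  Every Hägg word `s`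
agrees on the window `−K ≤ i ≤ K` with a Hägg word `s'` of period `2K + 1` — the periodic extension
`s' i = s (−K + ((i + K) mod (2K+1)))` of its restriction to the window. [folklore] -/
theorem stub_existsPeriodicHaggAgree :
    ∀ (s : ℤ → ℤ) (K : ℕ), IsHaggSeq s →
      ∃ (s' : ℤ → ℤ) (p : ℕ), p ≠ 0 ∧ IsHaggSeq s' ∧ (∀ i : ℤ, s' (i + p) = s' i) ∧
        ∀ i : ℤ, -(K : ℤ) ≤ i → i ≤ K → s' i = s i := by
  intro s K hs
  refine ⟨fun i => s (-(K : ℤ) + (i + K) % ((2 * K + 1 : ℕ) : ℤ)), 2 * K + 1, by omega, fun i => hs _, ?_, ?_⟩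
  · intro i
    simp only
    congr 2
    push_cast
    rw [show i + (2 * (K : ℤ) + 1) + K = (i + K) + (2 * (K : ℤ) + 1) by ring, Int.add_emod_right]
  · intro i hi1 hi2
    simp only
    congr 1
    have h0 : 0 ≤ i + K := by omega
    have h1 : i + K < ((2 * K + 1 : ℕ) : ℤ) := by push_cast; omega
    rw [Int.emod_eq_of_lt h0 h1]
    ring

end Summit.AtomisticToContinuum.Crystallization.Theorems.NashClassCertificatesNashNearField

end
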